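import Literature.Barriers.CriticalPhenomena.LaceExpansionXSpaceWeightedPieces
import HarnessLib

/-!
# Distributing the weight `|x|^b` along a path of a chain of pair kernels (Hara 2008, §3.4, Step 1)
# — PROVED

Barrier catalogue `Literature/Barriers/CriticalPhenomena/` (D-0021). Sixth layer under
`Hara2008_weightedNLoopBoundPc` (`LaceExpansionXSpaceLemma16.lean`): Hara's Step 1 ("there are two (upper
and lower) disjoint paths which connect `0` and `x`. Out of each line, we pick up the longest segment …
Because there are at most `(2N+1)` segments … these 'long' segments are not shorter than `|x|/(2N+1)`"),
in the summed form used for Lemma 1.6 (`|x|^b ≤ (2N+1)^b Σ_j |d_j|^b`, `x = Σ_j d_j` the displacements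
along the path; Heydenreich–van der Hofstad use the analogous split of `1 - cos(k·x)`, Lemma 7.3 and
§7.5.2), formalized ON THE CHAINS of `LaceExpansionXSpaceKernelNorms.lean`: each kernel carries a reader
`φ_i` of the path position after it, the displacement of its path line is `φ_i(q) - φ_{i-1}(p)`, and the
weight `|φ_m - o|^b` at the end is pushed onto the lines one at a time (Jensen for `b ≥ 1`,
subadditivity for `b ≤ 1`). PROVED:

* `add_rpow_le_jensen`, `euclidNorm_add_rpow_le`, `wE_add_le` (the one-step split
  `|u+w|^b ≤ ((m+2)/(m+1))^{(b-1)⁺}|u|^b + (m+2)^{(b-1)⁺}|w|^b`), the constants `jK b m = (m+1)^{(b-1)⁺} ≤ (m+1)^b`;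
* `kernelsOf`, `lastReader`, `markK` (a kernel with its line weighted by `|φ(q) - φ'(p)|^b`), `markedSum`
  (the sum over the position of one mark), `markedSum_append_singleton`;
* `tsum_pkChainL_weight_le` — **the weight-insertion estimate**:
  `Σ_p (vX₁⋯X_m)(p) e(p) |φ_m(p) - o|^b ≤ K_b(m) [Σ_p ((v|φ₀-o|^b)X₁⋯X_m)(p) e(p) + markedSum]`.

## References

* T. Hara, Ann. Probab. 36 (2008) 530–593 (arXiv:math-ph/0504021): §3.4 (Step 1; Step 3: "The number of
  choices of 'long' segments are bounded by `(2N+1)²`").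
* M. Heydenreich, R. van der Hofstad, *Progress in High-Dimensional Percolation and Random Graphs*,
  Springer 2017: Lemma 7.3 ((7.2.16)), §7.5.2 ("We distribute the factor `1 - cos(k·x)` among the
  displacements `d_j`").
-/

noncomputable section

namespace Literature.Barriers.CriticalPhenomena

open _root_.MeasureTheory _root_.Filter Literature.Probability.LatticeModels
  Literature.Probability.Percolation

open scoped ENNReal

/-! ### Distributing a weight `|Σ displacements|^b` along a chain (Hara 2008, §3.4, Step 1) -/

section WeightInsertion

variable {d : ℕ}

/-- **Jensen for the power `b ≥ 1`**: `(x + y)^b ≤ (1-θ)^{1-b} x^b + θ^{1-b} y^b` for `x, y ≥ 0`,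
`0 < θ < 1`. [folklore] -/
theorem add_rpow_le_jensen {b θ x y : ℝ} (hb : 1 ≤ b) (hθ : 0 < θ) (hθ1 : θ < 1) (hx : 0 ≤ x) (hy : 0 ≤ y) :
    (x + y) ^ b ≤ (1 - θ) ^ (1 - b) * x ^ b + θ ^ (1 - b) * y ^ b := by
  have h1θ : 0 < 1 - θ := by linarith
  have hconv := (convexOn_rpow hb).2 (Set.mem_Ici.2 (div_nonneg hx h1θ.le))
    (Set.mem_Ici.2 (div_nonneg hy hθ.le)) h1θ.le hθ.le (by ring : (1 - θ) + θ = 1)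
  simp only [smul_eq_mul] at hconv
  rw [mul_div_cancel₀ _ h1θ.ne', mul_div_cancel₀ _ hθ.ne', Real.div_rpow hx h1θ.le,
    Real.div_rpow hy hθ.le] at hconv
  calc (x + y) ^ b ≤ (1 - θ) * (x ^ b / (1 - θ) ^ b) + θ * (y ^ b / θ ^ b) := hconv
    _ = (1 - θ) ^ (1 - b) * x ^ b + θ ^ (1 - b) * y ^ b := by
        rw [Real.rpow_sub h1θ, Real.rpow_sub hθ, Real.rpow_one, Real.rpow_one]
        field_simp

/-- The exponent `(b - 1)⁺` of the polynomial constants. [folklore] -/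
def jExp (b : ℝ) : ℝ := max (b - 1) 0

/-- `(b-1)⁺ ≥ 0`. [folklore] -/
theorem jExp_nonneg (b : ℝ) : 0 ≤ jExp b := le_max_right _ _

/-- **The one-step weight split** `|u + w|^b ≤ ((m+2)/(m+1))^{(b-1)⁺} |u|^b + (m+2)^{(b-1)⁺} |w|^b`
(`b ≥ 0`; Jensen with `θ = 1/(m+2)` for `b ≥ 1`, subadditivity for `b ≤ 1`). [folklore] -/
theorem euclidNorm_add_rpow_le {b : ℝ} (hb : 0 ≤ b) (m : ℕ) (u w : Site d) :
    euclidNorm (u + w) ^ b ≤ (((m : ℝ) + 2) / ((m : ℝ) + 1)) ^ jExp b * euclidNorm u ^ b +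
      ((m : ℝ) + 2) ^ jExp b * euclidNorm w ^ b := by
  have hu := euclidNorm_nonneg u
  have hw := euclidNorm_nonneg w
  have hm1 : (0 : ℝ) < (m : ℝ) + 1 := by positivity
  have hm2 : (0 : ℝ) < (m : ℝ) + 2 := by positivity
  have htri : euclidNorm (u + w) ^ b ≤ (euclidNorm u + euclidNorm w) ^ b :=
    Real.rpow_le_rpow (euclidNorm_nonneg _) (euclidNorm_add_le u w) hb
  refine htri.trans ?_
  rcases le_total b 1 with hb1 | hb1
  · -- subadditive regime
    have hj : jExp b = 0 := max_eq_right (by linarith)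
    rw [hj, Real.rpow_zero, Real.rpow_zero, one_mul, one_mul]
    exact Real.rpow_add_le_add_rpow hu hw hb hb1
  · -- Jensen regime, θ = 1/(m+2)
    have hj : jExp b = b - 1 := max_eq_left (by linarith)
    have hθ : (0 : ℝ) < 1 / ((m : ℝ) + 2) := by positivity
    have hθ1 : 1 / ((m : ℝ) + 2) < 1 := by rw [div_lt_one hm2]; linarith
    have hJ := add_rpow_le_jensen hb1 hθ hθ1 hu hw
    have e1 : (1 - 1 / ((m : ℝ) + 2)) ^ (1 - b) = (((m : ℝ) + 2) / ((m : ℝ) + 1)) ^ jExp b := by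
      rw [hj, show 1 - 1 / ((m : ℝ) + 2) = (((m : ℝ) + 2) / ((m : ℝ) + 1))⁻¹ by field_simp; ring,
        Real.inv_rpow (div_nonneg hm2.le hm1.le), ← Real.rpow_neg (div_nonneg hm2.le hm1.le), neg_sub]
    have e2 : (1 / ((m : ℝ) + 2)) ^ (1 - b) = ((m : ℝ) + 2) ^ jExp b := by
      rw [hj, one_div, Real.inv_rpow hm2.le, ← Real.rpow_neg hm2.le, neg_sub]
    rw [e1, e2] at hJ
    exact hJ

/-- **The one-step weight split in `[0, ∞]`**: `|u + w|^b ≤ c₁ |u|^b + c₂ |w|^b` with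
`c₁ = ((m+2)/(m+1))^{(b-1)⁺}`, `c₂ = (m+2)^{(b-1)⁺}`. [folklore] -/
theorem wE_add_le {b : ℝ} (hb : 0 ≤ b) (m : ℕ) (u w : Site d) :
    wE b (u + w) ≤ ENNReal.ofReal ((((m : ℝ) + 2) / ((m : ℝ) + 1)) ^ jExp b) * wE b u +
      ENNReal.ofReal (((m : ℝ) + 2) ^ jExp b) * wE b w := by
  have h1 : (0 : ℝ) ≤ (((m : ℝ) + 2) / ((m : ℝ) + 1)) ^ jExp b := Real.rpow_nonneg (by positivity) _
  have h2 : (0 : ℝ) ≤ ((m : ℝ) + 2) ^ jExp b := Real.rpow_nonneg (by positivity) _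
  have hu : (0 : ℝ) ≤ euclidNorm u ^ b := Real.rpow_nonneg (euclidNorm_nonneg u) _
  have hw : (0 : ℝ) ≤ euclidNorm w ^ b := Real.rpow_nonneg (euclidNorm_nonneg w) _
  rw [wE, wE, wE, ← ENNReal.ofReal_mul h1, ← ENNReal.ofReal_mul h2,
    ← ENNReal.ofReal_add (mul_nonneg h1 hu) (mul_nonneg h2 hw)]
  exact ENNReal.ofReal_le_ofReal (euclidNorm_add_rpow_le hb m u w)

/-- The polynomial constant `K_b(m) = (m+1)^{(b-1)⁺}` (`(m+1)^{b-1}` from Jensen for `b ≥ 1`, `1` for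
`b ≤ 1`; in either case `≤ (m+1)^b`). [folklore] -/
def jK (b : ℝ) (m : ℕ) : ℝ≥0∞ := ENNReal.ofReal (((m : ℝ) + 1) ^ jExp b)

/-- `K_b(0) = 1`. [folklore] -/
@[simp] theorem jK_zero (b : ℝ) : jK b 0 = 1 := by simp [jK]

/-- The constants multiply up: `((m+2)/(m+1))^{(b-1)⁺} K_b(m) = K_b(m+1) = (m+2)^{(b-1)⁺}`. [folklore] -/
theorem jK_succ (b : ℝ) (m : ℕ) :
    ENNReal.ofReal ((((m : ℝ) + 2) / ((m : ℝ) + 1)) ^ jExp b) * jK b m = jK b (m + 1) ∧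
      ENNReal.ofReal (((m : ℝ) + 2) ^ jExp b) = jK b (m + 1) := by
  have hm1 : (0 : ℝ) < (m : ℝ) + 1 := by positivity
  have hm2 : (0 : ℝ) ≤ (m : ℝ) + 2 := by positivity
  have hcast : ((m + 1 : ℕ) : ℝ) + 1 = (m : ℝ) + 2 := by push_cast; ring
  refine ⟨?_, ?_⟩
  · rw [jK, jK, ← ENNReal.ofReal_mul (by positivity), ← Real.mul_rpow (by positivity) hm1.le,
      div_mul_cancel₀ _ hm1.ne', hcast]
  · rw [jK, hcast]

/-- Kernels bundled with the reader of the path position after them. [folklore] -/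
def kernelsOf (Xs : List ((Site d × Site d → Site d × Site d → ℝ≥0∞) × (Site d × Site d → Site d))) :
    List (Site d × Site d → Site d × Site d → ℝ≥0∞) := Xs.map Prod.fst

/-- The reader of the path position at the end of a chain (`φ₀` for the empty chain). [folklore] -/
def lastReader (φ₀ : Site d × Site d → Site d)
    (Xs : List ((Site d × Site d → Site d × Site d → ℝ≥0∞) × (Site d × Site d → Site d))) :
    Site d × Site d → Site d := Xs.foldl (fun _ x => x.2) φ₀

/-- The kernel `X` with its line weighted by `|φ(q) - φ'(p)|^b` (its displacement along the path). [cite: Hara2008, §3.4 (Step 1)] -/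
def markK (b : ℝ) (φ' φ : Site d × Site d → Site d) (X : Site d × Site d → Site d × Site d → ℝ≥0∞)
    (p q : Site d × Site d) : ℝ≥0∞ := X p q * wE b (φ q - φ' p)

/-- **The sum over the position of one mark**: `Σ_i [chain with the line of the i-th kernel weighted]`,
by structural recursion (head marked + marks in the tail). [cite: Hara2008, §3.4 (Step 1)] -/
def markedSum (b : ℝ) : (Site d × Site d → ℝ≥0∞) → (Site d × Site d → Site d) →
    List ((Site d × Site d → Site d × Site d → ℝ≥0∞) × (Site d × Site d → Site d)) →
    (Site d × Site d → ℝ≥0∞) → ℝ≥0∞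
  | _, _, [], _ => 0
  | v, φ', Xφ :: Xs, e => (∑' p, pkChainL (pkVmul v (markK b φ' Xφ.2 Xφ.1)) (kernelsOf Xs) p * e p) +
      markedSum b (pkVmul v Xφ.1) Xφ.2 Xs e

/-- Kernels of the empty list. [folklore] -/
@[simp] theorem kernelsOf_nil : kernelsOf ([] : List ((Site d × Site d → Site d × Site d → ℝ≥0∞) ×
    (Site d × Site d → Site d))) = [] := rfl

/-- Kernels of a cons. [folklore] -/
@[simp] theorem kernelsOf_cons (x : (Site d × Site d → Site d × Site d → ℝ≥0∞) × (Site d × Site d → Site d))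
    (Xs : List _) : kernelsOf (x :: Xs) = x.1 :: kernelsOf Xs := rfl

/-- Kernels of a snoc. [folklore] -/
theorem kernelsOf_append_singleton (Xs : List ((Site d × Site d → Site d × Site d → ℝ≥0∞) ×
    (Site d × Site d → Site d))) (x : _) : kernelsOf (Xs ++ [x]) = kernelsOf Xs ++ [x.1] := by
  simp [kernelsOf]

/-- Last reader of the empty chain. [folklore] -/
@[simp] theorem lastReader_nil (φ₀ : Site d × Site d → Site d) : lastReader φ₀ [] = φ₀ := rfl

/-- Last reader of a cons. [folklore] -/
@[simp] theorem lastReader_cons (φ₀ : Site d × Site d → Site d)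
    (x : (Site d × Site d → Site d × Site d → ℝ≥0∞) × (Site d × Site d → Site d)) (Xs : List _) :
    lastReader φ₀ (x :: Xs) = lastReader x.2 Xs := rfl

/-- Last reader of a snoc. [folklore] -/
theorem lastReader_append_singleton (φ₀ : Site d × Site d → Site d)
    (Xs : List ((Site d × Site d → Site d × Site d → ℝ≥0∞) × (Site d × Site d → Site d))) (x : _) :
    lastReader φ₀ (Xs ++ [x]) = x.2 := by
  simp [lastReader, List.foldl_append]

/-- The kernel list has the same length. [folklore] -/
theorem length_kernelsOf (Xs : List ((Site d × Site d → Site d × Site d → ℝ≥0∞) × (Site d × Site d → Site d))) :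
    (kernelsOf Xs).length = Xs.length := List.length_map _

/-- Pairing a chain extended by one kernel: `Σ_p (w Ks X)(p) e(p) = Σ_p (w Ks)(p) (X e)(p)`. [folklore] -/
theorem tsum_pkChainL_append_singleton_mul (w : Site d × Site d → ℝ≥0∞)
    (Ks : List (Site d × Site d → Site d × Site d → ℝ≥0∞)) (X : Site d × Site d → Site d × Site d → ℝ≥0∞)
    (e : Site d × Site d → ℝ≥0∞) :
    ∑' p, pkChainL w (Ks ++ [X]) p * e p = ∑' p, pkChainL w Ks p * pkKvec X e p := by
  rw [pkChainL_append, pkChainL_cons, pkChainL_nil, tsum_pkVmul_mul]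

/-- The one-mark sum of a chain extended by one kernel: marks in the old part (paired with `X e`) plus
the mark on the new kernel. [folklore] -/
theorem markedSum_append_singleton (b : ℝ) (v : Site d × Site d → ℝ≥0∞) (φ' : Site d × Site d → Site d)
    (Xs : List ((Site d × Site d → Site d × Site d → ℝ≥0∞) × (Site d × Site d → Site d))) (x : _)
    (e : Site d × Site d → ℝ≥0∞) :
    markedSum b v φ' (Xs ++ [x]) e = markedSum b v φ' Xs (pkKvec x.1 e) +
      ∑' p, pkChainL v (kernelsOf Xs) p * pkKvec (markK b (lastReader φ' Xs) x.2 x.1) e p := by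
  induction Xs generalizing v φ' with
  | nil =>
    show (∑' p, pkChainL (pkVmul v (markK b φ' x.2 x.1)) (kernelsOf []) p * e p) +
        markedSum b (pkVmul v x.1) x.2 [] e = markedSum b v φ' [] (pkKvec x.1 e) + _
    simp only [markedSum, kernelsOf_nil, pkChainL_nil, lastReader_nil, add_zero, zero_add]
    exact tsum_pkVmul_mul _ _ _
  | cons y Xs ih =>
    show (∑' p, pkChainL (pkVmul v (markK b φ' y.2 y.1)) (kernelsOf (Xs ++ [x])) p * e p) +
        markedSum b (pkVmul v y.1) y.2 (Xs ++ [x]) e =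
      ((∑' p, pkChainL (pkVmul v (markK b φ' y.2 y.1)) (kernelsOf Xs) p * pkKvec x.1 e p) +
        markedSum b (pkVmul v y.1) y.2 Xs (pkKvec x.1 e)) +
      ∑' p, pkChainL v (kernelsOf (y :: Xs)) p * pkKvec (markK b (lastReader φ' (y :: Xs)) x.2 x.1) e p
    rw [ih, kernelsOf_append_singleton, tsum_pkChainL_append_singleton_mul, kernelsOf_cons, pkChainL_cons,
      lastReader_cons, add_assoc]

/-- **Distributing a weight along a chain** (Hara's Step 1: "|x| ≤ Σ_j |d_j|", "these 'long' segments
are not shorter than `|x|/(2N+1)`", in the form `|x|^b ≤ (2N+1)^b Σ_j |d_j|^b` and inserted line by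
line): for kernels `X₁, …, X_m` with readers `φ₁, …, φ_m` of the path position after each, a start
reader `φ₀`, an origin `o` and `b ≥ 0`,
`Σ_p (v X₁⋯X_m)(p) e(p) |φ_m(p) - o|^b ≤ K_b(m) [ Σ_p ((v |φ₀ - o|^b) X₁⋯X_m)(p) e(p)
  + Σ_i Σ_p (v X₁ ⋯ (X_i |φ_i - φ_{i-1}|^b) ⋯ X_m)(p) e(p) ]`, `K_b(m) = (m+1)^{(b-1)⁺}`.
[cite: Hara2008, §3.4 (Step 1)] [cite: HeydenreichVanDerHofstad2017, Lemma 7.3 and §7.5.2 (the analogous split of 1 - cos)] -/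
theorem tsum_pkChainL_weight_le {b : ℝ} (hb : 0 ≤ b) (v : Site d × Site d → ℝ≥0∞)
    (φ₀ : Site d × Site d → Site d) (o : Site d)
    (Xs : List ((Site d × Site d → Site d × Site d → ℝ≥0∞) × (Site d × Site d → Site d)))
    (e : Site d × Site d → ℝ≥0∞) :
    ∑' p, pkChainL v (kernelsOf Xs) p * (e p * wE b (lastReader φ₀ Xs p - o)) ≤
      jK b Xs.length * ((∑' p, pkChainL (fun p => v p * wE b (φ₀ p - o)) (kernelsOf Xs) p * e p) +
        markedSum b v φ₀ Xs e) := by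
  induction Xs using List.reverseRecOn generalizing e with
  | nil =>
    simp only [kernelsOf_nil, pkChainL_nil, lastReader_nil, List.length_nil, jK_zero, one_mul, markedSum,
      add_zero]
    exact le_of_eq (tsum_congr fun p => by ring)
  | append_singleton Xs x ih =>
    rw [kernelsOf_append_singleton, lastReader_append_singleton, tsum_pkChainL_append_singleton_mul,
      List.length_append, List.length_singleton, markedSum_append_singleton,
      tsum_pkChainL_append_singleton_mul]
    set m := Xs.length with hm
    set c₁ : ℝ≥0∞ := ENNReal.ofReal ((((m : ℝ) + 2) / ((m : ℝ) + 1)) ^ jExp b) with hc₁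
    set c₂ : ℝ≥0∞ := ENNReal.ofReal (((m : ℝ) + 2) ^ jExp b) with hc₂
    set φ' := lastReader φ₀ Xs with hφ'
    -- pointwise split of the weight inside `X (e |φ - o|^b)`
    have hsplit : ∀ p : Site d × Site d, pkKvec x.1 (fun q => e q * wE b (x.2 q - o)) p ≤
        c₁ * (wE b (φ' p - o) * pkKvec x.1 e p) + c₂ * pkKvec (markK b φ' x.2 x.1) e p := by
      intro p
      calc pkKvec x.1 (fun q => e q * wE b (x.2 q - o)) p
          ≤ ∑' q, x.1 p q * (e q * (c₁ * wE b (φ' p - o) + c₂ * wE b (x.2 q - φ' p))) := by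
            refine ENNReal.tsum_le_tsum fun q => mul_le_mul' le_rfl (mul_le_mul' le_rfl ?_)
            have h := wE_add_le hb m (φ' p - o) (x.2 q - φ' p)
            rwa [show φ' p - o + (x.2 q - φ' p) = x.2 q - o by abel] at h
        _ = c₁ * (wE b (φ' p - o) * pkKvec x.1 e p) + c₂ * pkKvec (markK b φ' x.2 x.1) e p := by
            simp only [pkKvec, markK]
            rw [← ENNReal.tsum_mul_left, ← ENNReal.tsum_mul_left, ← ENNReal.tsum_mul_left, ← ENNReal.tsum_add]
            exact tsum_congr fun q => by ring
    calc ∑' p, pkChainL v (kernelsOf Xs) p * pkKvec x.1 (fun q => e q * wE b (x.2 q - o)) p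
        ≤ ∑' p, pkChainL v (kernelsOf Xs) p *
            (c₁ * (wE b (φ' p - o) * pkKvec x.1 e p) + c₂ * pkKvec (markK b φ' x.2 x.1) e p) :=
          ENNReal.tsum_le_tsum fun p => mul_le_mul' le_rfl (hsplit p)
      _ = c₁ * ∑' p, pkChainL v (kernelsOf Xs) p * (pkKvec x.1 e p * wE b (φ' p - o)) +
            c₂ * ∑' p, pkChainL v (kernelsOf Xs) p * pkKvec (markK b φ' x.2 x.1) e p := by
          rw [← ENNReal.tsum_mul_left, ← ENNReal.tsum_mul_left, ← ENNReal.tsum_add]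
          exact tsum_congr fun p => by ring
      _ ≤ c₁ * (jK b m * ((∑' p, pkChainL (fun p => v p * wE b (φ₀ p - o)) (kernelsOf Xs) p * pkKvec x.1 e p) +
            markedSum b v φ₀ Xs (pkKvec x.1 e))) +
            c₂ * ∑' p, pkChainL v (kernelsOf Xs) p * pkKvec (markK b φ' x.2 x.1) e p :=
          add_le_add (mul_le_mul' le_rfl (ih _)) le_rfl
      _ = jK b (m + 1) * ((∑' p, pkChainL (fun p => v p * wE b (φ₀ p - o)) (kernelsOf Xs) p * pkKvec x.1 e p) +
            (markedSum b v φ₀ Xs (pkKvec x.1 e) +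
              ∑' p, pkChainL v (kernelsOf Xs) p * pkKvec (markK b φ' x.2 x.1) e p)) := by
          rw [hc₁, hc₂, ← mul_assoc, (jK_succ b m).1, (jK_succ b m).2]
          ring

/-- **The constant is polynomial**: `K_b(m) ≤ (m+1)^b` for `b ≥ 0`. [folklore] -/
theorem jK_le {b : ℝ} (hb : 0 ≤ b) (m : ℕ) : jK b m ≤ ENNReal.ofReal (((m : ℝ) + 1) ^ b) := by
  refine ENNReal.ofReal_le_ofReal (Real.rpow_le_rpow_of_exponent_le (by linarith [(Nat.cast_nonneg m : (0:ℝ) ≤ m)]) ?_)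
  exact max_le (by linarith) hb

end WeightInsertion

end Literature.Barriers.CriticalPhenomena
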